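import Summits.ValiantsHypothesis.ValiantsHypothesis.Theorems.LacunarySymmetroidMatrixDescartesStubDescartesCeiling
import Summits.ValiantsHypothesis.ValiantsHypothesis.Theorems.LacunarySymmetroidMatrixDescartesStubNegRoots

/-!
# `MatrixDescartes` — the RANK CEILING: a size-free Descartes bound, and the bounded-rank sector at every size

HONEST FRAMING.  Object-search cell `pub-symmetroid`, crux `Theses.LacunarySymmetroid.MatrixDescartes`
(ledger item `stmt-ValiantsHypothesis-18050`, route `LacunarySymmetroid`; seat `val-sym-mdr-p1`).  The crux implies
`VP ≠ VNP` by the route's assembly and is at least summit-hard; NOTHING here is progress on it and nothing here is a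
claim about `VP ≠ VNP`.  This file proves one elementary STRUCTURAL upper bound and records the sector of the crux it
settles.

**Rank ceiling** (`card_posRoots_succ_le_prod_rank_succ`).  For every `K`-term lacunary pencil `F = ∑ X^(d l) • S l`
with real `m × m` coefficients (no symmetry needed) and any bounds `rank S l ≤ r l`,

  `Z₊(det F) + 1 ≤ ∏ l, (r l + 1)`,

INDEPENDENTLY OF THE SIZE `m`.  Proof: in the Leibniz expansion the coefficient of `X^n` is a sum, over the
column-to-term maps `f : Fin m → Fin K` with `∑ i, d (f i) = n`, of the determinants of the column-selection matrices
`(r, i) ↦ S (f i) r i` (tree `StubDescartesCeiling.det_pencil_eq`, regrouped: `det_pencil_eq_sum_colMap`,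
`coeff_det_pencil_colMap`); if some fibre `f⁻¹(l)` has more than `rank (S l)` elements, that matrix has more than `rank (S l)`
columns taken from `S l`, hence is singular (`det_colMap_eq_zero_of_rank_lt`); so the support of `det F` is indexed by
count vectors `t` with `t l ≤ r l`, at most `∏ (r l + 1)` of them (`card_support_det_pencil_le_prod`), and a nonzero real
polynomial has fewer positive zeros than monomials (tree sparse Descartes rule).  With `r l = m` for every `l` this is
weaker than the tree's count-vector ceiling `C(m+K−1, m)` (`stub_descartesCeiling`); its point is that LOW-RANK
coefficients cap the zero count by a function of `K` and the ranks alone.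

**The bounded-rank sector of the crux, at every size** (`matrixDescartes_rankSector`).  Consequently, for all `r, q`
there is `K₀` such that for ALL `K ≥ K₀` and ALL sizes `m` — no quasi-polynomial size hypothesis — every `K`-term real
symmetric pencil whose coefficients all have rank `≤ r` satisfies the crux's inequality `Z^q ≤ 2^(K⌊log₂K⌋)`
(`Z ≤ 2(r+1)^K − 1` by the ceiling for the pencil and its reflection).  Contrast: without the size hypothesis the crux is
FALSE in general (`MatrixDescartes.Negative.matrixDescartes_false_without_sizeBound`, diagonal witness with full-rank
coefficients); the rank sector is exactly where size stops mattering.  A sector theorem — it says nothing about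
full-rank coefficients, where the crux lives.

[folklore] Elementary linear algebra (column rank) + the tree's sparse Descartes rule
`Literature.Computability.AlgebraicComplexity.card_roots_toFinset_filter_pos_lt_card_support`.
-/

-- `Summit.ValiantsHypothesis.ValiantsHypothesis.…` repeats a component by the D-0017 layout
-- (single-conjunct summit), which the `dupNamespace` linter flags; the name is mandated.
set_option linter.dupNamespace false

namespace Summit.ValiantsHypothesis.ValiantsHypothesis.Theorems.LacunarySymmetroidMatrixDescartes.Census

open Polynomial Finset
open scoped BigOperators Polynomial Matrix

/-! ## §1 The Leibniz expansion regrouped by column-to-term maps -/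

/-- The pencil determinant as a sum over column-to-term maps `f : Fin m → Fin K` of
`C (det M_f) · X^(∑ i, d (f i))`, where `M_f (r, i) = S (f i) r i` takes column `i` from the coefficient `S (f i)`
(multilinearity of `det` in the columns). [folklore] -/
theorem det_pencil_eq_sum_colMap {K m : ℕ} (d : Fin K → ℕ) (S : Fin K → Matrix (Fin m) (Fin m) ℝ) :
    Matrix.det (∑ l, ((Polynomial.X : Polynomial ℝ) ^ d l) • (S l).map Polynomial.C) =
      ∑ f : Fin m → Fin K, C (Matrix.det (Matrix.of fun r i => S (f i) r i)) * X ^ (∑ i, d (f i)) := by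
  rw [StubDescartesCeiling.det_pencil_eq, Finset.sum_comm]
  refine Finset.sum_congr rfl fun f _ => ?_
  rw [Matrix.det_apply', map_sum, Finset.sum_mul]
  refine Finset.sum_congr rfl fun σ _ => ?_
  simp only [Matrix.of_apply, map_mul, map_intCast]
  ring

/-- Coefficient formula: the coefficient of `X^n` in the pencil determinant is the sum of `det M_f` over the
column-to-term maps `f` with exponent `∑ i, d (f i) = n`. [folklore] -/
theorem coeff_det_pencil_colMap {K m : ℕ} (d : Fin K → ℕ) (S : Fin K → Matrix (Fin m) (Fin m) ℝ) (n : ℕ) :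
    (Matrix.det (∑ l, ((Polynomial.X : Polynomial ℝ) ^ d l) • (S l).map Polynomial.C)).coeff n =
      ∑ f ∈ (Finset.univ : Finset (Fin m → Fin K)).filter (fun f => (∑ i, d (f i)) = n),
        Matrix.det (Matrix.of fun r i => S (f i) r i) := by
  rw [det_pencil_eq_sum_colMap, finsetSum_coeff, Finset.sum_filter]
  refine Finset.sum_congr rfl fun f _ => ?_
  rw [coeff_C_mul_X_pow]
  by_cases h : (∑ i, d (f i)) = n
  · rw [if_pos h.symm, if_pos h]
  · rw [if_neg (fun h' => h h'.symm), if_neg h]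

/-! ## §2 Rank kills large fibres -/

/-- If a column-to-term map `f` takes more than `rank (S l)` columns from the coefficient `S l`, the column-selection
matrix `M_f` is singular: those columns are linearly dependent. [folklore] -/
theorem det_colMap_eq_zero_of_rank_lt {K m : ℕ} (S : Fin K → Matrix (Fin m) (Fin m) ℝ) (f : Fin m → Fin K)
    (l : Fin K) (h : (S l).rank < (Finset.univ.filter (fun i => f i = l)).card) :
    Matrix.det (Matrix.of fun r i => S (f i) r i) = 0 := by
  by_contra hne
  set M : Matrix (Fin m) (Fin m) ℝ := Matrix.of fun r i => S (f i) r i with hM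
  have hU : IsUnit M := (Matrix.isUnit_iff_isUnit_det M).2 (isUnit_iff_ne_zero.2 hne)
  have hli : LinearIndependent ℝ M.col := Matrix.linearIndependent_cols_iff_isUnit.2 hU
  -- restrict the column family to the fibre of `l`
  have hli' : LinearIndependent ℝ (fun i : {i : Fin m // f i = l} => M.col i.1) :=
    hli.comp (fun i : {i : Fin m // f i = l} => i.1) Subtype.val_injective
  -- those columns are columns of `S l`, inside the column span of `S l`
  set W : Submodule ℝ (Fin m → ℝ) := Submodule.span ℝ (Set.range (S l).col) with hW
  have hcol : ∀ i : {i : Fin m // f i = l}, M.col i.1 = (S l).col i.1 := by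
    intro i
    funext r
    change M r i.1 = S l r i.1
    rw [hM, Matrix.of_apply, i.2]
  have hmem : ∀ i : {i : Fin m // f i = l}, M.col i.1 ∈ W := fun i => by
    rw [hcol i]
    exact Submodule.subset_span ⟨i.1, rfl⟩
  have hli'' : LinearIndependent ℝ (fun i : {i : Fin m // f i = l} => (⟨M.col i.1, hmem i⟩ : W)) := by
    refine LinearIndependent.of_comp W.subtype ?_
    exact hli'
  have hcard := hli''.fintype_card_le_finrank
  rw [hW, ← Matrix.rank_eq_finrank_span_cols, Fintype.card_subtype] at hcard
  omega

/-! ## §3 Counting the surviving exponents -/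

/-- The exponent of a column-to-term map is determined by its count vector:
`∑ i, d (f i) = ∑ l, #f⁻¹(l) · d l`. [folklore] -/
theorem sum_eq_sum_card_fiber_mul {K m : ℕ} (d : Fin K → ℕ) (f : Fin m → Fin K) :
    ∑ i, d (f i) = ∑ l, (Finset.univ.filter (fun i => f i = l)).card * d l := by
  rw [← Finset.sum_fiberwise_of_maps_to (s := Finset.univ) (t := Finset.univ) (g := f)
    (fun i _ => Finset.mem_univ (f i)) (fun i => d (f i))]
  refine Finset.sum_congr rfl fun l _ => ?_
  rw [Finset.sum_congr rfl (fun i hi => by rw [(Finset.mem_filter.1 hi).2] :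
      ∀ i ∈ Finset.univ.filter (fun i => f i = l), d (f i) = d l),
    Finset.sum_const, smul_eq_mul]

/-- The support of the pencil determinant is indexed by count vectors `t` with `t l ≤ r l` whenever
`rank (S l) ≤ r l` for all `l`. [folklore] -/
theorem support_det_pencil_subset_rank {K m : ℕ} (d : Fin K → ℕ) (S : Fin K → Matrix (Fin m) (Fin m) ℝ)
    (r : Fin K → ℕ) (hr : ∀ l, (S l).rank ≤ r l) :
    (Matrix.det (∑ l, ((Polynomial.X : Polynomial ℝ) ^ d l) • (S l).map Polynomial.C)).support ⊆
      (Finset.univ : Finset ((l : Fin K) → Fin (r l + 1))).image (fun t => ∑ l, (t l : ℕ) * d l) := by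
  intro n hn
  rw [mem_support_iff, coeff_det_pencil_colMap] at hn
  obtain ⟨f, hf, hdet⟩ := Finset.exists_ne_zero_of_sum_ne_zero hn
  rw [Finset.mem_filter] at hf
  have hfib : ∀ l, (Finset.univ.filter (fun i => f i = l)).card ≤ r l := by
    intro l
    by_contra hlt
    exact hdet (det_colMap_eq_zero_of_rank_lt S f l (lt_of_le_of_lt (hr l) (not_le.1 hlt)))
  refine Finset.mem_image.2 ⟨fun l => ⟨(Finset.univ.filter (fun i => f i = l)).card, Nat.lt_succ_of_le (hfib l)⟩,
    Finset.mem_univ _, ?_⟩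
  rw [← hf.2, sum_eq_sum_card_fiber_mul]

/-- Hence the pencil determinant has at most `∏ l, (r l + 1)` monomials. [folklore] -/
theorem card_support_det_pencil_le_prod {K m : ℕ} (d : Fin K → ℕ) (S : Fin K → Matrix (Fin m) (Fin m) ℝ)
    (r : Fin K → ℕ) (hr : ∀ l, (S l).rank ≤ r l) :
    (Matrix.det (∑ l, ((Polynomial.X : Polynomial ℝ) ^ d l) • (S l).map Polynomial.C)).support.card ≤
      ∏ l, (r l + 1) := by
  calc (Matrix.det (∑ l, ((Polynomial.X : Polynomial ℝ) ^ d l) • (S l).map Polynomial.C)).support.card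
      ≤ ((Finset.univ : Finset ((l : Fin K) → Fin (r l + 1))).image (fun t => ∑ l, (t l : ℕ) * d l)).card :=
        Finset.card_le_card (support_det_pencil_subset_rank d S r hr)
    _ ≤ (Finset.univ : Finset ((l : Fin K) → Fin (r l + 1))).card := Finset.card_image_le
    _ = ∏ l, (r l + 1) := by
        rw [Finset.card_univ, Fintype.card_pi]
        simp only [Fintype.card_fin]

/-! ## §4 The rank ceiling -/

/-- **RANK CEILING.**  For a `K`-term lacunary pencil `∑ X^(d l) • S l` with real `m × m` coefficients of ranks
`rank (S l) ≤ r l`, the number `Z₊` of distinct positive zeros of the determinant satisfies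
`Z₊ + 1 ≤ ∏ l, (r l + 1)` — independently of `m`; no symmetry is needed.  (With `r l = m` throughout it is implied
by the tree's sharper count-vector ceiling `stub_descartesCeiling`.) [folklore] -/
theorem card_posRoots_succ_le_prod_rank_succ {K m : ℕ} (d : Fin K → ℕ) (S : Fin K → Matrix (Fin m) (Fin m) ℝ)
    (r : Fin K → ℕ) (hr : ∀ l, (S l).rank ≤ r l) :
    ((Matrix.det (∑ l, ((Polynomial.X : Polynomial ℝ) ^ d l) • (S l).map Polynomial.C)).roots.toFinset.filter
        (fun t => 0 < t)).card + 1 ≤ ∏ l, (r l + 1) := by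
  have hprod : 0 < ∏ l, (r l + 1) := Finset.prod_pos fun l _ => Nat.succ_pos _
  by_cases hP : Matrix.det (∑ l, ((Polynomial.X : Polynomial ℝ) ^ d l) • (S l).map Polynomial.C) = 0
  · rw [hP, Polynomial.roots_zero, Multiset.toFinset_zero, Finset.filter_empty, Finset.card_empty, zero_add]
    exact hprod
  · have h1 :=
      Literature.Computability.AlgebraicComplexity.card_roots_toFinset_filter_pos_lt_card_support hP
    exact Nat.succ_le_of_lt (lt_of_lt_of_le h1 (card_support_det_pencil_le_prod d S r hr))

/-- Uniform version: if every coefficient has rank `≤ r` then `Z₊ + 1 ≤ (r + 1)^K`, for every size `m`. [folklore] -/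
theorem card_posRoots_succ_le_pow_of_rank_le {K m : ℕ} (d : Fin K → ℕ) (S : Fin K → Matrix (Fin m) (Fin m) ℝ)
    (r : ℕ) (hr : ∀ l, (S l).rank ≤ r) :
    ((Matrix.det (∑ l, ((Polynomial.X : Polynomial ℝ) ^ d l) • (S l).map Polynomial.C)).roots.toFinset.filter
        (fun t => 0 < t)).card + 1 ≤ (r + 1) ^ K := by
  have h := card_posRoots_succ_le_prod_rank_succ d S (fun _ => r) hr
  rwa [Finset.prod_const, Finset.card_univ, Fintype.card_fin] at h

/-! ## §5 The bounded-rank sector of the crux, at every size -/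

/-- Scalar multiples do not increase the rank (`c • A = (c • 1) * A`). [folklore] -/
theorem rank_smul_le {m : ℕ} (c : ℝ) (A : Matrix (Fin m) (Fin m) ℝ) : (c • A).rank ≤ A.rank := by
  have h : c • A = (c • (1 : Matrix (Fin m) (Fin m) ℝ)) * A := by rw [Matrix.smul_mul, Matrix.one_mul]
  rw [h]
  exact Matrix.rank_mul_le_right _ _

/-- All distinct real zeros under a uniform rank bound: `Z ≤ 2(r+1)^K − 1` (the ceiling for the pencil and for its
reflection `S l ↦ (−1)^(d l) • S l`, which has the same ranks, plus the origin; tree `stub_negRoots`). [folklore] -/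
theorem card_roots_le_of_rank_le {K m : ℕ} (d : Fin K → ℕ) (S : Fin K → Matrix (Fin m) (Fin m) ℝ)
    (r : ℕ) (hr : ∀ l, (S l).rank ≤ r) :
    (Matrix.det (∑ l, ((Polynomial.X : Polynomial ℝ) ^ d l) • (S l).map Polynomial.C)).roots.toFinset.card + 1
      ≤ 2 * (r + 1) ^ K := by
  have h1 := card_posRoots_succ_le_pow_of_rank_le d S r hr
  have h2 := card_posRoots_succ_le_pow_of_rank_le d (fun l => ((-1 : ℝ) ^ d l) • S l) r
    (fun l => (rank_smul_le _ _).trans (hr l))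
  have h3 := stub_negRoots K m d S
  omega

/-- **`MatrixDescartes` holds on the bounded-rank sector AT EVERY SIZE.**  For all `r, q` there is `K₀` such that for
all `K ≥ K₀`, ALL `m` (no size hypothesis), all exponents and all real symmetric `m × m` coefficients of rank `≤ r`,
the crux's inequality `Z^q ≤ 2^(K⌊log₂K⌋)` holds: `Z ≤ 2(r+1)^K − 1 < 2^((b+1)K)` with `2r+2 < 2^(b+1)`,
`b = ⌊log₂(2r+2)⌋`, and `q(b+1)K ≤ K⌊log₂K⌋` once `K ≥ 2^(q(b+1))`.  Contrast `matrixDescartes_false_without_sizeBound`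
(full-rank diagonal witness): the size hypothesis of the crux is load-bearing exactly because of full-rank
coefficients.  Symmetry is not used. [folklore] -/
theorem matrixDescartes_rankSector (r q : ℕ) : ∃ K₀ : ℕ, ∀ K m : ℕ, K₀ ≤ K →
    ∀ (d : Fin K → ℕ) (S : Fin K → Matrix (Fin m) (Fin m) ℝ), (∀ l, (S l).rank ≤ r) →
      (Matrix.det (∑ l, ((Polynomial.X : Polynomial ℝ) ^ d l) • (S l).map Polynomial.C)).roots.toFinset.card ^ q
        ≤ 2 ^ (K * Nat.log 2 K) := by
  set b := Nat.log 2 (2 * r + 2) with hb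
  refine ⟨2 ^ (q * (b + 1)), fun K m hK d S hr => ?_⟩
  have hZ := card_roots_le_of_rank_le d S r hr
  -- `2(r+1)^K ≤ (2r+2)^K ≤ 2^((b+1)K)` for `K ≥ 1`; `K = 0` is trivial
  have h2r : 2 * r + 2 ≤ 2 ^ (b + 1) := (Nat.lt_pow_succ_log_self one_lt_two (2 * r + 2)).le
  have hlog : q * (b + 1) ≤ Nat.log 2 K := Nat.le_log_of_pow_le one_lt_two hK
  have hK1 : 1 ≤ K := le_trans Nat.one_le_two_pow hK
  have hZ' : (Matrix.det (∑ l, ((Polynomial.X : Polynomial ℝ) ^ d l) • (S l).map Polynomial.C)).roots.toFinset.card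
      ≤ 2 ^ ((b + 1) * K) := by
    have e1 : 2 * (r + 1) ^ K ≤ (2 * r + 2) ^ K := by
      have h2K : 2 ≤ 2 ^ K :=
        calc 2 = 2 ^ 1 := (pow_one 2).symm
          _ ≤ 2 ^ K := Nat.pow_le_pow_right (by norm_num) hK1
      calc 2 * (r + 1) ^ K ≤ 2 ^ K * (r + 1) ^ K := Nat.mul_le_mul_right _ h2K
        _ = (2 * (r + 1)) ^ K := (mul_pow 2 (r + 1) K).symm
        _ = (2 * r + 2) ^ K := by ring
    calc _ ≤ 2 * (r + 1) ^ K := by omega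
      _ ≤ (2 * r + 2) ^ K := e1
      _ ≤ (2 ^ (b + 1)) ^ K := Nat.pow_le_pow_left h2r K
      _ = 2 ^ ((b + 1) * K) := by rw [← pow_mul]
  calc (Matrix.det (∑ l, ((Polynomial.X : Polynomial ℝ) ^ d l) • (S l).map Polynomial.C)).roots.toFinset.card ^ q
      ≤ (2 ^ ((b + 1) * K)) ^ q := Nat.pow_le_pow_left hZ' q
    _ = 2 ^ (q * (b + 1) * K) := by rw [← pow_mul]; congr 1; ring
    _ ≤ 2 ^ (K * Nat.log 2 K) := Nat.pow_le_pow_right (by norm_num) (by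
        calc q * (b + 1) * K = K * (q * (b + 1)) := by ring
          _ ≤ K * Nat.log 2 K := Nat.mul_le_mul_left K hlog)

end Summit.ValiantsHypothesis.ValiantsHypothesis.Theorems.LacunarySymmetroidMatrixDescartes.Census
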